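import Literature.Computability.QuantumComplexity.GluedTreesThm9Defs
import HarnessLib

/-!
# Glued trees, Theorem 9 (classical lower bound) — I: the local structure of `G'_n(σ)`

Support file for the proof of `ChildsEtAl2003_thm9` (Childs–Cleve–Deotto–Farhi–Gutmann–Spielman,
*Exponential algorithmic speedup by a quantum walk*, STOC 2003, Theorem 9). This file contains no
probability: it describes the neighbourhoods of the glued-trees graph `GluedTrees.graph n σ` of
`GluedTrees.lean` vertex by vertex, which is what both halves of the printed proof use
("the neighbors of `π(i)` in `G` other than `π(l)`", §4, p. 12):

* children versus parents (`parentV_childV`, `isChild_iff_eq_parentV`, `isChild_iff_eq_childV`),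
  leaves and their cross neighbours along the alternating cycle `σ = (e, f)` (`isGlued_iff`,
  `cross₁_leafL`, …; the coordinates themselves are defined in `GluedTreesThm9Defs`);
* the neighbour finsets: `neighborFinset_leafL`, `neighborFinset_leafR` (parent + two cross
  neighbours) and `neighborFinset_of_depth_lt` (parent if any + two children), and the degrees
  (`2` at the two roots, `3` elsewhere, for `1 ≤ n`);
* the number of vertices `card_vertex : |Vertex n| = 2^(n+2) - 2`;
* the onward options `stepOpts σ v u` of `GluedTreesThm9Defs`: case-by-case values and
  `stepOpts_toFinset` (for `u` a neighbour of `v` they list exactly the other neighbours, without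
  repetition), `length_stepOpts`, `degree_eq`.

## References

* [ChildsEtAl2003] A. M. Childs et al., Exponential algorithmic speedup by a quantum walk,
  STOC 2003, §2 (the graphs `G'_n`), §4 (proof of Theorem 9).
-/

namespace Literature.Computability.QuantumComplexity

namespace GluedTrees

open Finset

variable {n : ℕ}

/-! ### Children and parents -/

/-- The two children of an inner vertex are distinct. [folklore] -/
theorem childV_false_ne_true {v : Vertex n} (h : depth v < n) : childV v false ≠ childV v true := by
  intro heq
  have := congrArg idx heq
  rw [idx_childV h, idx_childV h] at this
  simp at this

/-- The parent of a child is the vertex itself. [folklore] -/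
theorem parentV_childV {v : Vertex n} (h : depth v < n) (b : Bool) : parentV (childV v b) = v := by
  rw [Vertex.ext_iff']
  refine ⟨by simp [childV_fst], ?_, ?_⟩
  · rw [depth_parentV, depth_childV h]; rfl
  · rw [idx_parentV, idx_childV h]
    have hb : b.toNat ≤ 1 := Bool.toNat_le b
    omega

/-- A child differs from its parent-to-be. [folklore] -/
theorem childV_ne_self {v : Vertex n} (h : depth v < n) (b : Bool) : childV v b ≠ v := by
  intro heq
  have := congrArg depth heq
  rw [depth_childV h] at this
  omega

/-- A non-root vertex differs from its parent. [folklore] -/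
theorem parentV_ne_self {v : Vertex n} (h : 1 ≤ depth v) : parentV v ≠ v := by
  intro heq
  have := congrArg depth heq
  rw [depth_parentV] at this
  omega

/-! ### Children and parents versus `IsChild` -/

/-- `IsChild` in coordinates. [cite: ChildsEtAl2003, §2] -/
theorem isChild_iff {u v : Vertex n} :
    IsChild u v ↔ u.1 = v.1 ∧ depth u = depth v + 1 ∧ idx u / 2 = idx v := Iff.rfl

/-- `v` is a child of `u` iff `v` is not a root and `u` is its parent. [cite: ChildsEtAl2003, §2] -/
theorem isChild_iff_eq_parentV {u v : Vertex n} : IsChild v u ↔ 1 ≤ depth v ∧ u = parentV v := by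
  rw [isChild_iff]
  constructor
  · rintro ⟨hs, hd, hi⟩
    refine ⟨by omega, ?_⟩
    rw [Vertex.ext_iff']
    exact ⟨hs.symm, by rw [depth_parentV]; omega, by rw [idx_parentV, hi]⟩
  · rintro ⟨hd, rfl⟩
    exact ⟨rfl, by rw [depth_parentV]; omega, rfl⟩

/-- `u` is a child of `v` iff `v` is not a leaf and `u` is one of its two children.
[cite: ChildsEtAl2003, §2] -/
theorem isChild_iff_eq_childV {u v : Vertex n} :
    IsChild u v ↔ depth v < n ∧ (u = childV v false ∨ u = childV v true) := by
  rw [isChild_iff]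
  constructor
  · rintro ⟨hs, hd, hi⟩
    have hvn : depth v < n := by have := depth_le u; omega
    refine ⟨hvn, ?_⟩
    rcases Nat.mod_two_eq_zero_or_one (idx u) with h0 | h1
    · left
      rw [Vertex.ext_iff']
      refine ⟨by rw [childV_fst, hs], by rw [depth_childV hvn, hd], ?_⟩
      rw [idx_childV hvn]
      simp only [Bool.toNat_false, add_zero]
      omega
    · right
      rw [Vertex.ext_iff']
      refine ⟨by rw [childV_fst, hs], by rw [depth_childV hvn, hd], ?_⟩
      rw [idx_childV hvn]
      simp only [Bool.toNat_true]
      omega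
  · rintro ⟨hvn, h⟩
    rcases h with rfl | rfl
    · refine ⟨childV_fst _ _, depth_childV hvn _, ?_⟩
      rw [idx_childV hvn]
      simp
    · refine ⟨childV_fst _ _, depth_childV hvn _, ?_⟩
      rw [idx_childV hvn]
      simp only [Bool.toNat_true]
      omega

/-! ### Leaves and the cross edges -/

/-- Left leaves are on the left. [folklore] -/
@[simp] theorem leafL_fst (i : Fin (2 ^ n)) : (leafL n i).1 = false := rfl
/-- Right leaves are on the right. [folklore] -/
@[simp] theorem leafR_fst (i : Fin (2 ^ n)) : (leafR n i).1 = true := rfl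
/-- Left leaves have depth `n`. [folklore] -/
@[simp] theorem depth_leafL (i : Fin (2 ^ n)) : depth (leafL n i) = n := rfl
/-- Right leaves have depth `n`. [folklore] -/
@[simp] theorem depth_leafR (i : Fin (2 ^ n)) : depth (leafR n i) = n := rfl
/-- The position of a left leaf. [folklore] -/
@[simp] theorem idx_leafL (i : Fin (2 ^ n)) : idx (leafL n i) = i := rfl
/-- The position of a right leaf. [folklore] -/
@[simp] theorem idx_leafR (i : Fin (2 ^ n)) : idx (leafR n i) = i := rfl
/-- The ENTRANCE is a root. [folklore] -/
@[simp] theorem depth_entrance : depth (entrance n) = 0 := rfl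
/-- The EXIT is a root. [folklore] -/
@[simp] theorem depth_exit : depth (exit n) = 0 := rfl
/-- The ENTRANCE is on the left. [folklore] -/
@[simp] theorem entrance_fst : (entrance n).1 = false := rfl
/-- The EXIT is on the right. [folklore] -/
@[simp] theorem exit_fst : (exit n).1 = true := rfl

/-- `leafL` is injective. [folklore] -/
theorem leafL_injective : Function.Injective (leafL n) := by
  intro i j h
  have := congrArg idx h
  simp only [idx_leafL] at this
  exact Fin.ext this

/-- `leafR` is injective. [folklore] -/
theorem leafR_injective : Function.Injective (leafR n) := by
  intro i j h
  have := congrArg idx h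
  simp only [idx_leafR] at this
  exact Fin.ext this

/-- `leafL` is injective (iff form). [folklore] -/
@[simp] theorem leafL_inj {i j : Fin (2 ^ n)} : leafL n i = leafL n j ↔ i = j := leafL_injective.eq_iff
/-- `leafR` is injective (iff form). [folklore] -/
@[simp] theorem leafR_inj {i j : Fin (2 ^ n)} : leafR n i = leafR n j ↔ i = j := leafR_injective.eq_iff

/-- A left leaf is not a right leaf. [folklore] -/
theorem leafL_ne_leafR (i j : Fin (2 ^ n)) : leafL n i ≠ leafR n j := by
  intro h; have := congrArg Prod.fst h; simp at this

/-- A vertex of depth `n` is the leaf with its side and position. [folklore] -/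
theorem eq_leaf_of_depth_eq {v : Vertex n} (h : depth v = n) :
    v = (if v.1 then leafR n ⟨idx v, (idx_lt v).trans_eq (by rw [h])⟩
      else leafL n ⟨idx v, (idx_lt v).trans_eq (by rw [h])⟩) := by
  rw [Vertex.ext_iff']
  cases hv : v.1 <;> simp [h]

/-- For `1 ≤ n` the rotation of `Fin (2 ^ n)` has no fixed point. [folklore] -/
theorem finRotate_apply_ne (hn : 1 ≤ n) (k : Fin (2 ^ n)) : finRotate (2 ^ n) k ≠ k := by
  have h2 : 2 ≤ 2 ^ n := by
    calc 2 = 2 ^ 1 := rfl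
      _ ≤ 2 ^ n := Nat.pow_le_pow_right two_pos hn
  obtain ⟨m, hm⟩ : ∃ m, 2 ^ n = m + 2 := ⟨2 ^ n - 2, by omega⟩
  revert k
  rw [hm]
  intro k heq
  have h := congrArg Fin.val heq
  rw [coe_finRotate] at h
  split_ifs at h with hl
  · subst hl
    simp at h
  · omega

/-- The two cross neighbours of a left leaf are distinct (`1 ≤ n`). [cite: ChildsEtAl2003, §2] -/
theorem crossR_fst_ne_snd (hn : 1 ≤ n) (σ : CycleDatum n) (i : Fin (2 ^ n)) :
    (crossR σ i).1 ≠ (crossR σ i).2 := by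
  simp only [crossR, ne_eq, EmbeddingLike.apply_eq_iff_eq]
  intro h
  have := (finRotate (2 ^ n)).apply_symm_apply (σ.1.symm i)
  rw [← h] at this
  exact finRotate_apply_ne hn _ this

/-- The two cross neighbours of a right leaf are distinct (`1 ≤ n`). [cite: ChildsEtAl2003, §2] -/
theorem crossL_fst_ne_snd (hn : 1 ≤ n) (σ : CycleDatum n) (i : Fin (2 ^ n)) :
    (crossL σ i).1 ≠ (crossL σ i).2 := by
  simp only [crossL, ne_eq, EmbeddingLike.apply_eq_iff_eq]
  exact (finRotate_apply_ne hn _).symm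

/-- The cycle is symmetric: `j` is a cross neighbour of the left leaf `i` iff `i` is a cross
neighbour of the right leaf `j`. [cite: ChildsEtAl2003, §2] -/
theorem crossL_crossR_fst (σ : CycleDatum n) (i : Fin (2 ^ n)) : (crossL σ (crossR σ i).1).1 = i := by
  simp [crossL, crossR]

/-- Symmetry of the cycle, second cross neighbour. [cite: ChildsEtAl2003, §2] -/
theorem crossL_crossR_snd (σ : CycleDatum n) (i : Fin (2 ^ n)) : (crossL σ (crossR σ i).2).2 = i := by
  simp [crossL, crossR]

/-- Symmetry of the cycle, from the right, first cross neighbour. [cite: ChildsEtAl2003, §2] -/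
theorem crossR_crossL_fst (σ : CycleDatum n) (i : Fin (2 ^ n)) : (crossR σ (crossL σ i).1).1 = i := by
  simp [crossL, crossR]

/-- Symmetry of the cycle, from the right, second cross neighbour. [cite: ChildsEtAl2003, §2] -/
theorem crossR_crossL_snd (σ : CycleDatum n) (i : Fin (2 ^ n)) : (crossR σ (crossL σ i).2).2 = i := by
  simp [crossL, crossR]

/-- `IsGlued` unfolded along `crossR`/`crossL`: the directed cycle edges out of a vertex.
[cite: ChildsEtAl2003, §2] -/
theorem isGlued_iff (σ : CycleDatum n) (u v : Vertex n) :
    IsGlued σ u v ↔ (∃ i, u = leafL n i ∧ v = leafR n (crossR σ i).1) ∨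
      (∃ i, u = leafR n i ∧ v = leafL n (crossL σ i).2) := by
  unfold IsGlued
  constructor
  · rintro ⟨k, ⟨rfl, rfl⟩ | ⟨rfl, rfl⟩⟩
    · exact Or.inl ⟨σ.1 k, rfl, by simp [crossR]⟩
    · exact Or.inr ⟨σ.2 k, rfl, by simp [crossL]⟩
  · rintro (⟨i, rfl, rfl⟩ | ⟨i, rfl, rfl⟩)
    · exact ⟨σ.1.symm i, Or.inl ⟨by simp, rfl⟩⟩
    · exact ⟨σ.2.symm i, Or.inr ⟨by simp, rfl⟩⟩

/-- Glued vertices are leaves. [cite: ChildsEtAl2003, §2] -/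
theorem depth_eq_of_isGlued {σ : CycleDatum n} {u v : Vertex n} (h : IsGlued σ u v) :
    depth u = n ∧ depth v = n := by
  obtain ⟨k, ⟨rfl, rfl⟩ | ⟨rfl, rfl⟩⟩ := h <;> exact ⟨rfl, rfl⟩

/-! ### Neighbourhoods -/

/-- The neighbours of a non-leaf vertex: its parent (unless it is a root) and its two children.
[cite: ChildsEtAl2003, §2] -/
theorem neighborFinset_of_depth_lt (σ : CycleDatum n) {v : Vertex n} (hv : depth v < n) :
    (graph n σ).neighborFinset v =
      (if depth v = 0 then ∅ else {parentV v}) ∪ {childV v false, childV v true} := by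
  ext u
  rw [SimpleGraph.mem_neighborFinset, graph_adj]
  simp only [Finset.mem_union, Finset.mem_insert, Finset.mem_singleton]
  constructor
  · rintro ⟨hne, (hc | hg) | (hc | hg)⟩
    · -- `v` is a child of `u`: `u` is the parent
      obtain ⟨hd, rfl⟩ := isChild_iff_eq_parentV.mp hc
      left
      rw [if_neg (by omega)]
      exact Finset.mem_singleton_self _
    · exact absurd (depth_eq_of_isGlued hg).1 (by omega)
    · right
      exact (isChild_iff_eq_childV.mp hc).2
    · exact absurd (depth_eq_of_isGlued hg).2 (by omega)
  · rintro (h | h)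
    · split_ifs at h with h0
      · simp at h
      · rw [Finset.mem_singleton] at h
        subst h
        exact ⟨(parentV_ne_self (by omega)).symm, Or.inl (Or.inl (isChild_iff_eq_parentV.mpr ⟨by omega, rfl⟩))⟩
    · have hc : IsChild u v := isChild_iff_eq_childV.mpr ⟨hv, h⟩
      refine ⟨?_, Or.inr (Or.inl hc)⟩
      rcases h with rfl | rfl <;> exact (childV_ne_self hv _).symm

/-- The neighbours of the left leaf `i` (`1 ≤ n`): its parent and its two cross neighbours
`f (e⁻¹ i)`, `f (e⁻¹ i - 1)`. [cite: ChildsEtAl2003, §2] -/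
theorem neighborFinset_leafL (hn : 1 ≤ n) (σ : CycleDatum n) (i : Fin (2 ^ n)) :
    (graph n σ).neighborFinset (leafL n i) =
      {parentV (leafL n i), leafR n (crossR σ i).1, leafR n (crossR σ i).2} := by
  ext u
  rw [SimpleGraph.mem_neighborFinset, graph_adj]
  simp only [Finset.mem_insert, Finset.mem_singleton]
  constructor
  · rintro ⟨hne, (hc | hg) | (hc | hg)⟩
    · exact Or.inl (isChild_iff_eq_parentV.mp hc).2
    · rw [isGlued_iff] at hg
      rcases hg with ⟨j, hj, rfl⟩ | ⟨j, hj, rfl⟩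
      · rw [leafL_inj] at hj; subst hj
        exact Or.inr (Or.inl rfl)
      · exact absurd hj (leafL_ne_leafR _ _)
    · have := (isChild_iff_eq_childV.mp hc).1
      simp at this
    · rw [isGlued_iff] at hg
      rcases hg with ⟨j, rfl, hj⟩ | ⟨j, rfl, hj⟩
      · exact absurd hj (leafL_ne_leafR _ _)
      · rw [leafL_inj] at hj; subst hj
        right; right
        simp [crossR, crossL]
  · rintro (rfl | rfl | rfl)
    · refine ⟨(parentV_ne_self (by simp; omega)).symm, Or.inl (Or.inl ?_)⟩
      exact isChild_iff_eq_parentV.mpr ⟨by simp; omega, rfl⟩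
    · refine ⟨leafL_ne_leafR _ _, Or.inl (Or.inr ?_)⟩
      rw [isGlued_iff]
      exact Or.inl ⟨i, rfl, rfl⟩
    · refine ⟨leafL_ne_leafR _ _, Or.inr (Or.inr ?_)⟩
      rw [isGlued_iff]
      refine Or.inr ⟨(crossR σ i).2, rfl, ?_⟩
      rw [crossL_crossR_snd]

/-- The neighbours of the right leaf `i` (`1 ≤ n`): its parent and its two cross neighbours
`e (f⁻¹ i)`, `e (f⁻¹ i + 1)`. [cite: ChildsEtAl2003, §2] -/
theorem neighborFinset_leafR (hn : 1 ≤ n) (σ : CycleDatum n) (i : Fin (2 ^ n)) :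
    (graph n σ).neighborFinset (leafR n i) =
      {parentV (leafR n i), leafL n (crossL σ i).1, leafL n (crossL σ i).2} := by
  ext u
  rw [SimpleGraph.mem_neighborFinset, graph_adj]
  simp only [Finset.mem_insert, Finset.mem_singleton]
  constructor
  · rintro ⟨hne, (hc | hg) | (hc | hg)⟩
    · exact Or.inl (isChild_iff_eq_parentV.mp hc).2
    · rw [isGlued_iff] at hg
      rcases hg with ⟨j, hj, rfl⟩ | ⟨j, hj, rfl⟩
      · exact absurd hj.symm (leafL_ne_leafR _ _)
      · rw [leafR_inj] at hj; subst hj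
        exact Or.inr (Or.inr rfl)
    · have := (isChild_iff_eq_childV.mp hc).1
      simp at this
    · rw [isGlued_iff] at hg
      rcases hg with ⟨j, rfl, hj⟩ | ⟨j, rfl, hj⟩
      · rw [leafR_inj] at hj; subst hj
        right; left
        simp [crossR, crossL]
      · exact absurd hj.symm (leafL_ne_leafR _ _)
  · rintro (rfl | rfl | rfl)
    · refine ⟨(parentV_ne_self (by simp; omega)).symm, Or.inl (Or.inl ?_)⟩
      exact isChild_iff_eq_parentV.mpr ⟨by simp; omega, rfl⟩
    · refine ⟨(leafL_ne_leafR _ _).symm, Or.inr (Or.inr ?_)⟩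
      rw [isGlued_iff]
      refine Or.inl ⟨(crossL σ i).1, rfl, ?_⟩
      rw [crossR_crossL_fst]
    · refine ⟨(leafL_ne_leafR _ _).symm, Or.inl (Or.inr ?_)⟩
      rw [isGlued_iff]
      exact Or.inr ⟨i, rfl, rfl⟩

/-! ### Degrees and the number of vertices -/

/-- A non-leaf, non-root vertex has degree `3`. [cite: ChildsEtAl2003, §2] -/
theorem degree_of_depth_lt (σ : CycleDatum n) {v : Vertex n} (hv : depth v < n) (h0 : depth v ≠ 0) :
    (graph n σ).degree v = 3 := by
  rw [← SimpleGraph.card_neighborFinset_eq_degree, neighborFinset_of_depth_lt σ hv, if_neg h0]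
  have h1 : parentV v ≠ childV v false := fun h ↦ by
    have := congrArg depth h; rw [depth_parentV, depth_childV hv] at this; omega
  have h2 : parentV v ≠ childV v true := fun h ↦ by
    have := congrArg depth h; rw [depth_parentV, depth_childV hv] at this; omega
  rw [Finset.card_union_of_disjoint (by simp [h1, h2]), Finset.card_singleton,
    Finset.card_pair (childV_false_ne_true hv)]

/-- A root has degree `2` (`1 ≤ n`). [cite: ChildsEtAl2003, §2] -/
theorem degree_of_depth_eq_zero (σ : CycleDatum n) {v : Vertex n} (hv : depth v = 0) (hn : 1 ≤ n) :
    (graph n σ).degree v = 2 := by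
  have hvn : depth v < n := by omega
  rw [← SimpleGraph.card_neighborFinset_eq_degree, neighborFinset_of_depth_lt σ hvn, if_pos hv,
    Finset.empty_union, Finset.card_pair (childV_false_ne_true hvn)]

/-- A left leaf has degree `3` (`1 ≤ n`). [cite: ChildsEtAl2003, §2] -/
theorem degree_leafL (hn : 1 ≤ n) (σ : CycleDatum n) (i : Fin (2 ^ n)) :
    (graph n σ).degree (leafL n i) = 3 := by
  rw [← SimpleGraph.card_neighborFinset_eq_degree, neighborFinset_leafL hn]
  have h1 : parentV (leafL n i) ≠ leafR n (crossR σ i).1 := fun h ↦ by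
    have := congrArg Prod.fst h; simp at this
  have h2 : parentV (leafL n i) ≠ leafR n (crossR σ i).2 := fun h ↦ by
    have := congrArg Prod.fst h; simp at this
  have h3 : leafR n (crossR σ i).1 ≠ leafR n (crossR σ i).2 := by
    rw [Ne, leafR_inj]; exact crossR_fst_ne_snd hn σ i
  rw [Finset.card_insert_of_notMem (by simp [h1, h2]), Finset.card_pair h3]

/-- A right leaf has degree `3` (`1 ≤ n`). [cite: ChildsEtAl2003, §2] -/
theorem degree_leafR (hn : 1 ≤ n) (σ : CycleDatum n) (i : Fin (2 ^ n)) :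
    (graph n σ).degree (leafR n i) = 3 := by
  rw [← SimpleGraph.card_neighborFinset_eq_degree, neighborFinset_leafR hn]
  have h1 : parentV (leafR n i) ≠ leafL n (crossL σ i).1 := fun h ↦ by
    have := congrArg Prod.fst h; simp at this
  have h2 : parentV (leafR n i) ≠ leafL n (crossL σ i).2 := fun h ↦ by
    have := congrArg Prod.fst h; simp at this
  have h3 : leafL n (crossL σ i).1 ≠ leafL n (crossL σ i).2 := by
    rw [Ne, leafL_inj]; exact crossL_fst_ne_snd hn σ i
  rw [Finset.card_insert_of_notMem (by simp [h1, h2]), Finset.card_pair h3]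

/-- `G'_n` has `2 (2^(n+1) - 1) = 2^(n+2) - 2` vertices. [cite: ChildsEtAl2003, §4 (proof of Lemma 4)] -/
theorem card_vertex (n : ℕ) : Fintype.card (Vertex n) = 2 ^ (n + 2) - 2 := by
  rw [Fintype.card_prod, Fintype.card_bool, Fintype.card_sigma]
  simp only [Fintype.card_fin]
  rw [Fin.sum_univ_eq_sum_range (fun j ↦ 2 ^ j) (n + 1), Nat.geomSum_eq le_rfl]
  have : 1 ≤ 2 ^ (n + 1) := Nat.one_le_two_pow
  have h4 : 2 ^ (n + 2) = 2 * 2 ^ (n + 1) := by rw [pow_succ]; ring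
  omega


/-! ### Leaves and their cross neighbours, uniformly -/

/-- `cross₁` of a left leaf. [cite: ChildsEtAl2003, §2] -/
@[simp] theorem cross₁_leafL (σ : CycleDatum n) (i : Fin (2 ^ n)) :
    cross₁ σ (leafL n i) = leafR n (crossR σ i).1 := by
  simp [cross₁, leafIdx, depth, idx, leafL]

/-- `cross₂` of a left leaf. [cite: ChildsEtAl2003, §2] -/
@[simp] theorem cross₂_leafL (σ : CycleDatum n) (i : Fin (2 ^ n)) :
    cross₂ σ (leafL n i) = leafR n (crossR σ i).2 := by
  simp [cross₂, leafIdx, depth, idx, leafL]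

/-- `cross₁` of a right leaf. [cite: ChildsEtAl2003, §2] -/
@[simp] theorem cross₁_leafR (σ : CycleDatum n) (i : Fin (2 ^ n)) :
    cross₁ σ (leafR n i) = leafL n (crossL σ i).1 := by
  simp [cross₁, leafIdx, depth, idx, leafR]

/-- `cross₂` of a right leaf. [cite: ChildsEtAl2003, §2] -/
@[simp] theorem cross₂_leafR (σ : CycleDatum n) (i : Fin (2 ^ n)) :
    cross₂ σ (leafR n i) = leafL n (crossL σ i).2 := by
  simp [cross₂, leafIdx, depth, idx, leafR]

/-- A vertex of depth `n` is `leafL i` or `leafR i`. [folklore] -/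
theorem exists_eq_leaf {v : Vertex n} (h : depth v = n) : ∃ i, v = leafL n i ∨ v = leafR n i := by
  refine ⟨⟨idx v, (idx_lt v).trans_eq (by rw [h])⟩, ?_⟩
  have := eq_leaf_of_depth_eq h
  cases hv : v.1
  · rw [hv] at this; exact Or.inl this
  · rw [hv] at this; exact Or.inr this

/-- The neighbours of a leaf `v` (`1 ≤ n`): its parent and its two cross neighbours.
[cite: ChildsEtAl2003, §2] -/
theorem neighborFinset_of_depth_eq (hn : 1 ≤ n) (σ : CycleDatum n) {v : Vertex n} (hv : depth v = n) :
    (graph n σ).neighborFinset v = {parentV v, cross₁ σ v, cross₂ σ v} := by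
  obtain ⟨i, rfl | rfl⟩ := exists_eq_leaf hv
  · rw [neighborFinset_leafL hn, cross₁_leafL, cross₂_leafL]
  · rw [neighborFinset_leafR hn, cross₁_leafR, cross₂_leafR]

/-- The two cross neighbours of a leaf are distinct (`1 ≤ n`). [cite: ChildsEtAl2003, §2] -/
theorem cross₁_ne_cross₂ (hn : 1 ≤ n) (σ : CycleDatum n) {v : Vertex n} (hv : depth v = n) :
    cross₁ σ v ≠ cross₂ σ v := by
  obtain ⟨i, rfl | rfl⟩ := exists_eq_leaf hv
  · rw [cross₁_leafL, cross₂_leafL, Ne, leafR_inj]; exact crossR_fst_ne_snd hn σ i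
  · rw [cross₁_leafR, cross₂_leafR, Ne, leafL_inj]; exact crossL_fst_ne_snd hn σ i

/-- A cross neighbour is on the other side. [cite: ChildsEtAl2003, §2] -/
theorem cross₁_fst {σ : CycleDatum n} {v : Vertex n} (hv : depth v = n) : (cross₁ σ v).1 = !v.1 := by
  obtain ⟨i, rfl | rfl⟩ := exists_eq_leaf hv <;> simp

/-- A cross neighbour is on the other side. [cite: ChildsEtAl2003, §2] -/
theorem cross₂_fst {σ : CycleDatum n} {v : Vertex n} (hv : depth v = n) : (cross₂ σ v).1 = !v.1 := by
  obtain ⟨i, rfl | rfl⟩ := exists_eq_leaf hv <;> simp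

/-- A cross neighbour is a leaf. [cite: ChildsEtAl2003, §2] -/
theorem depth_cross₁ {σ : CycleDatum n} {v : Vertex n} (hv : depth v = n) : depth (cross₁ σ v) = n := by
  obtain ⟨i, rfl | rfl⟩ := exists_eq_leaf hv <;> simp

/-- A cross neighbour is a leaf. [cite: ChildsEtAl2003, §2] -/
theorem depth_cross₂ {σ : CycleDatum n} {v : Vertex n} (hv : depth v = n) : depth (cross₂ σ v) = n := by
  obtain ⟨i, rfl | rfl⟩ := exists_eq_leaf hv <;> simp

/-- The parent of a leaf is not a cross neighbour. [folklore] -/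
theorem parentV_ne_cross₁ {σ : CycleDatum n} {v : Vertex n} (hv : depth v = n) : parentV v ≠ cross₁ σ v := by
  intro h
  have := congrArg Prod.fst h
  rw [parentV_fst, cross₁_fst hv] at this
  cases hb : v.1 <;> simp [hb] at this

/-- The parent of a leaf is not a cross neighbour. [folklore] -/
theorem parentV_ne_cross₂ {σ : CycleDatum n} {v : Vertex n} (hv : depth v = n) : parentV v ≠ cross₂ σ v := by
  intro h
  have := congrArg Prod.fst h
  rw [parentV_fst, cross₂_fst hv] at this
  cases hb : v.1 <;> simp [hb] at this

/-! ### The onward options `stepOpts` -/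

/-- `otherChild v` of the first child is the second. [folklore] -/
theorem otherChild_childV_false (v : Vertex n) : otherChild v (childV v false) = childV v true := by
  simp [otherChild]

/-- `otherChild v` of the second child is the first. [folklore] -/
theorem otherChild_childV_true {v : Vertex n} (h : depth v < n) : otherChild v (childV v true) = childV v false := by
  simp [otherChild, (childV_false_ne_true h).symm]

/-- Starting (no entering vertex) at a non-leaf, the options are the two children.
[cite: ChildsEtAl2003, §4 (Game 5)] -/
theorem stepOpts_none {σ : CycleDatum n} {v : Vertex n} (hv : depth v < n) :
    stepOpts σ v none = [childV v false, childV v true] := by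
  simp [stepOpts, hv]

/-- Entered from its parent, a non-leaf offers its two children. [cite: ChildsEtAl2003, §4 (Game 5)] -/
theorem stepOpts_parentV_of_depth_lt {σ : CycleDatum n} {v : Vertex n} (hv : depth v < n) :
    stepOpts σ v (some (parentV v)) = [childV v false, childV v true] := by
  simp [stepOpts, hv]

/-- Entered from a child, a non-root non-leaf offers its parent and the other child.
[cite: ChildsEtAl2003, §4 (Game 5)] -/
theorem stepOpts_childV {σ : CycleDatum n} {v : Vertex n} (hv : depth v < n) (h0 : depth v ≠ 0) (b : Bool) :
    stepOpts σ v (some (childV v b)) = [parentV v, childV v (!b)] := by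
  have hne : childV v b ≠ parentV v := fun h ↦ by
    have := congrArg depth h; rw [depth_childV hv, depth_parentV] at this; omega
  cases b
  · simp [stepOpts, hv, h0, hne, otherChild_childV_false]
  · simp [stepOpts, hv, h0, hne, otherChild_childV_true hv]

/-- Entered from a child, a root offers only the other child (the walk "exits").
[cite: ChildsEtAl2003, §4 (Game 5)] -/
theorem stepOpts_childV_of_depth_eq_zero {σ : CycleDatum n} {v : Vertex n} (hv : depth v < n)
    (h0 : depth v = 0) (b : Bool) : stepOpts σ v (some (childV v b)) = [childV v (!b)] := by
  have hne : childV v b ≠ parentV v := fun h ↦ by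
    have := congrArg depth h; rw [depth_childV hv, depth_parentV] at this; omega
  unfold stepOpts
  rw [if_pos hv]
  cases b
  · simp [h0, hne, otherChild_childV_false]
  · simp [h0, hne, otherChild_childV_true hv]

/-- Entered from its parent, a leaf offers its two cross neighbours. [cite: ChildsEtAl2003, §4 (Game 5)] -/
theorem stepOpts_parentV_of_depth_eq {σ : CycleDatum n} {v : Vertex n} (hv : depth v = n) :
    stepOpts σ v (some (parentV v)) = [cross₁ σ v, cross₂ σ v] := by
  simp [stepOpts, hv]

/-- Entered from its first cross neighbour, a leaf offers its parent and the second one.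
[cite: ChildsEtAl2003, §4 (Game 5)] -/
theorem stepOpts_cross₁ {σ : CycleDatum n} {v : Vertex n} (hv : depth v = n) :
    stepOpts σ v (some (cross₁ σ v)) = [parentV v, cross₂ σ v] := by
  simp [stepOpts, hv, (parentV_ne_cross₁ hv).symm]

/-- Entered from its second cross neighbour, a leaf offers its parent and the first one (`1 ≤ n`).
[cite: ChildsEtAl2003, §4 (Game 5)] -/
theorem stepOpts_cross₂ (hn : 1 ≤ n) {σ : CycleDatum n} {v : Vertex n} (hv : depth v = n) :
    stepOpts σ v (some (cross₂ σ v)) = [parentV v, cross₁ σ v] := by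
  simp [stepOpts, hv, (parentV_ne_cross₂ hv).symm, (cross₁_ne_cross₂ hn σ hv).symm]

/-- **`stepOpts` lists the other neighbours.** For `u` a neighbour of `v` (`1 ≤ n`), the onward
options of `v` entered from `u` are exactly the neighbours of `v` other than `u`, without
repetition. [cite: ChildsEtAl2003, §4 (Game 5)] -/
theorem stepOpts_toFinset (hn : 1 ≤ n) (σ : CycleDatum n) {v u : Vertex n}
    (hu : u ∈ (graph n σ).neighborFinset v) :
    (stepOpts σ v (some u)).toFinset = ((graph n σ).neighborFinset v).erase u ∧
      (stepOpts σ v (some u)).Nodup := by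
  by_cases hv : depth v < n
  · rw [neighborFinset_of_depth_lt σ hv] at hu ⊢
    have hpc : ∀ b, parentV v ≠ childV v b := fun b h ↦ by
      have := congrArg depth h; rw [depth_childV hv, depth_parentV] at this; omega
    by_cases h0 : depth v = 0
    · rw [if_pos h0] at hu ⊢
      rw [Finset.empty_union] at hu ⊢
      simp only [Finset.mem_insert, Finset.mem_singleton] at hu
      rcases hu with rfl | rfl
      · rw [stepOpts_childV_of_depth_eq_zero hv h0]
        refine ⟨?_, List.nodup_singleton _⟩
        rw [Finset.erase_insert (by simpa using childV_false_ne_true hv)]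
        simp
      · rw [stepOpts_childV_of_depth_eq_zero hv h0]
        refine ⟨?_, List.nodup_singleton _⟩
        rw [Finset.pair_comm, Finset.erase_insert (by simpa using (childV_false_ne_true hv).symm)]
        simp
    · rw [if_neg h0] at hu ⊢
      simp only [Finset.mem_union, Finset.mem_insert, Finset.mem_singleton] at hu
      rcases hu with rfl | rfl | rfl
      · rw [stepOpts_parentV_of_depth_lt hv, ← Finset.insert_eq,
          Finset.erase_insert (by simp [hpc])]
        exact ⟨by simp, by simp [childV_false_ne_true hv]⟩
      · rw [stepOpts_childV hv h0, ← Finset.insert_eq, Finset.erase_insert_of_ne (hpc false),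
          Finset.erase_insert (by simpa using childV_false_ne_true hv)]
        exact ⟨by simp, by simp [hpc]⟩
      · rw [stepOpts_childV hv h0, ← Finset.insert_eq, Finset.erase_insert_of_ne (hpc true),
          Finset.pair_comm, Finset.erase_insert (by simpa using (childV_false_ne_true hv).symm)]
        exact ⟨by simp, by simp [hpc]⟩
  · have hv' : depth v = n := le_antisymm (depth_le v) (not_lt.mp hv)
    rw [neighborFinset_of_depth_eq hn σ hv'] at hu ⊢
    have h12 := cross₁_ne_cross₂ hn σ hv'
    have hp1 := parentV_ne_cross₁ (σ := σ) hv'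
    have hp2 := parentV_ne_cross₂ (σ := σ) hv'
    simp only [Finset.mem_insert, Finset.mem_singleton] at hu
    rcases hu with rfl | rfl | rfl
    · rw [stepOpts_parentV_of_depth_eq hv', Finset.erase_insert (by simp [hp1, hp2])]
      exact ⟨by simp, by simp [h12]⟩
    · rw [stepOpts_cross₁ hv', Finset.erase_insert_of_ne hp1,
        Finset.erase_insert (by simpa using h12)]
      exact ⟨by simp, by simp [hp2]⟩
    · rw [stepOpts_cross₂ hn hv', Finset.erase_insert_of_ne hp2, Finset.pair_comm,
        Finset.erase_insert (by simpa using h12.symm)]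
      exact ⟨by simp, by simp [hp1]⟩

/-- The number of onward options is `2`, except `1` at a root entered from a child (`1 ≤ n`).
[cite: ChildsEtAl2003, §4 (Game 5)] -/
theorem length_stepOpts (hn : 1 ≤ n) (σ : CycleDatum n) {v u : Vertex n}
    (hu : u ∈ (graph n σ).neighborFinset v) :
    (stepOpts σ v (some u)).length = if depth v = 0 then 1 else 2 := by
  obtain ⟨h1, h2⟩ := stepOpts_toFinset hn σ hu
  have hlen : (stepOpts σ v (some u)).length = (((graph n σ).neighborFinset v).erase u).card := by
    rw [← h1, List.card_toFinset, h2.dedup]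
  rw [hlen, Finset.card_erase_of_mem hu, SimpleGraph.card_neighborFinset_eq_degree]
  by_cases h0 : depth v = 0
  · rw [if_pos h0, degree_of_depth_eq_zero σ h0 hn]
  · rw [if_neg h0]
    by_cases hv : depth v < n
    · rw [degree_of_depth_lt σ hv h0]
    · have hv' : depth v = n := le_antisymm (depth_le v) (not_lt.mp hv)
      obtain ⟨i, rfl | rfl⟩ := exists_eq_leaf hv'
      · rw [degree_leafL hn]
      · rw [degree_leafR hn]

/-- The degree of any vertex is `2` at a root and `3` otherwise (`1 ≤ n`). [cite: ChildsEtAl2003, §2] -/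
theorem degree_eq (hn : 1 ≤ n) (σ : CycleDatum n) (v : Vertex n) :
    (graph n σ).degree v = if depth v = 0 then 2 else 3 := by
  by_cases h0 : depth v = 0
  · rw [if_pos h0, degree_of_depth_eq_zero σ h0 hn]
  · rw [if_neg h0]
    by_cases hv : depth v < n
    · rw [degree_of_depth_lt σ hv h0]
    · have hv' : depth v = n := le_antisymm (depth_le v) (not_lt.mp hv)
      obtain ⟨i, rfl | rfl⟩ := exists_eq_leaf hv'
      · rw [degree_leafL hn]
      · rw [degree_leafR hn]

/-- Onward options are neighbours. [cite: ChildsEtAl2003, §4 (Game 5)] -/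
theorem mem_neighborFinset_of_mem_stepOpts (hn : 1 ≤ n) (σ : CycleDatum n) {v u w : Vertex n}
    (hu : u ∈ (graph n σ).neighborFinset v) (hw : w ∈ stepOpts σ v (some u)) :
    w ∈ (graph n σ).neighborFinset v := by
  have := (stepOpts_toFinset hn σ hu).1
  rw [← List.mem_toFinset, this] at hw
  exact Finset.mem_of_mem_erase hw

/-- Onward options differ from the entering vertex. [cite: ChildsEtAl2003, §4 (Game 5)] -/
theorem ne_of_mem_stepOpts (hn : 1 ≤ n) (σ : CycleDatum n) {v u w : Vertex n}
    (hu : u ∈ (graph n σ).neighborFinset v) (hw : w ∈ stepOpts σ v (some u)) : w ≠ u := by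
  have := (stepOpts_toFinset hn σ hu).1
  rw [← List.mem_toFinset, this] at hw
  exact Finset.ne_of_mem_erase hw

/-- The start options at the ENTRANCE are its neighbours (`1 ≤ n`). [cite: ChildsEtAl2003, §4 (Game 5)] -/
theorem stepOpts_entrance_none (hn : 1 ≤ n) (σ : CycleDatum n) :
    (stepOpts σ (entrance n) none).toFinset = (graph n σ).neighborFinset (entrance n) ∧
      (stepOpts σ (entrance n) none).Nodup ∧ (stepOpts σ (entrance n) none).length = 2 := by
  have h0 : depth (entrance n) < n := by simp; omega
  rw [stepOpts_none h0, neighborFinset_of_depth_lt σ h0, if_pos depth_entrance, Finset.empty_union]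
  exact ⟨by simp, by simp [childV_false_ne_true h0], rfl⟩

end GluedTrees

end Literature.Computability.QuantumComplexity
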